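import Summits.CriticalPhenomena.CardyFormulaZ2.Theses.CardySelfRefinement
import Literature.Probability.RandomPlanarGeometry.SLEUniquenessInLaw

/-!
# Line `scalar-subseq-sle-uniqueness` — skeleton for crux `SubseqUpgrade` (stmt-CriticalPhenomena-10279)

Route `route-CriticalPhenomena-CardySelfRefinement`, crux decl
`Summit.CriticalPhenomena.CardyFormulaZ2.Theses.CardySelfRefinement.SubseqUpgrade`
(subsequence principle: eventual a.e.-measurability of the bond-ℤ² interfaces + "every positive
null sequence of meshes has a subsequence along which the interface laws converge, for all `(D, E)`
at once, to a family of chordal SLE₆ laws" ⇒ `ConvergesInLawToSLE 6 D …` for every Dobrushin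
domain `D` and admissible discretisation family `E`).

Idea (card `Ideas/scalar-subseq-sle-uniqueness.md`, triage r1: pass ×3): SCALARISE. `TendstoLaw`
is "per bounded continuous test function `f`, a real net along `𝓝[>] 0`", so the crux splits into
exactly two lemmas, glued by `SubseqUpgrade_of` below:

* `stub_scalarSubseq` — the scalar subsequence principle on the countably generated filter
  `𝓝[>] (0 : ℝ)`, quantified over EVERYWHERE-positive null sequences (the form the crux's hypothesis
  delivers) and in its strongest form (the sub-selection `φ : ℕ → ℕ` needs no monotonicity, exactly
  as in Mathlib's `Filter.tendsto_of_subseq_tendsto`; the crux supplies `StrictMono φ`, which the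
  composition discards): `tendsto_of_subseq_tendsto` after an index shift past the finitely many
  non-positive terms of a sequence tending to `0` within `(0, ∞)`.
  Billingsley (1999), Thm. 2.6 (scalar form). Pure topology, model-free.
* `stub_slePin` — the UNIQUENESS PIN (the load-bearing step): if every positive null sequence has a
  subsequence along which the laws of random curves `Y δ` under `P δ` converge test-function-wise to
  SOME chordal SLE_κ law of `(D; a, b)`, then there is ONE chordal SLE_κ random curve `Γ` in `D` such
  that every positive null sequence has a subsequence along which they converge to the law of `Γ`.
  Model-free and κ-general; uses uniqueness of the chordal SLE_κ law
  (`IsSLELaw.eq_map_of_isSLECurve`, SLEUniquenessInLaw.lean — a PROVED theorem of the tree) and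
  `MeasureTheory.integral_map`; the witness `Γ` is read off the hypothesis along the mesh sequence
  `1/(n+1)` (no SLE existence fact is consumed). Lawler (2005), §6.1/§6.3.

`SubseqUpgrade_of` (sorry-free composition, concludes the crux BY NAME): specialise the crux's
hypothesis to the `(D, E)` at hand (its "one subsequence / one chordal family for all `(D, E)`"
strength is discarded), pin with `stub_slePin` (κ = 6, `Ωδ _ = BondConfig (Site 2)`,
`Y δ = bondInterfaceIn D (E δ)`, `P δ = bondPercolation (zdGraph 2) half`), copy the measurability
clause, and apply `stub_scalarSubseq` once per test function `f`.

Disproof used (`Cruxes/SubseqUpgrade/Disproof.lean`, standing disprover, NO KILL — the crux is a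
theorem): `not_subseqPrinciple_pair` / `subseqPrinciple_of_subsingleton` say any proof must use that
two chordal SLE₆ laws of the same Dobrushin domain coincide — honoured at `stub_slePin` (its only
non-topological step is `IsSLELaw.eq_map_of_isSLECurve`); `stub_scalarSubseq` is the principle with a
SINGLETON target `{a}`, i.e. the true side of that dichotomy, never the refuted two-point form. No
`_false_without_` theorem, no `-- Targets`, no landed `Theorems/SubseqUpgrade/Negative/*` exist.

STATUS OF THE STUBS: BOTH ARE ALREADY PROVED. The proof of each stub is reproduced verbatim in the
comment block right under it; with the two `sorry`s replaced by those blocks this file is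
`closed-scalar-subseq-sle-uniqueness.lean` of the crux-plan seat, checked 2026-08-16: `lean check`
rc 0, errors [], warnings [], sorries 0, axioms of `SubseqUpgrade_of` = {propext, Classical.choice,
Quot.sound}, audit `proof-of-item closed:true` against the route decl. (Four further independent
sorry-free proofs of the crux sit next to this file: `Disproof.lean` §Positive, `SketchIdeator1/2/3.lean`.)
Lead: land `stub_scalarSubseq` and `stub_slePin` with the proofs below (`propose --supports
stmt-CriticalPhenomena-10279`), then this file sorry-free with `--workitem stmt-CriticalPhenomena-10279`
as `Summits/CriticalPhenomena/CardyFormulaZ2/Theorems/CardySelfRefinementSubseqUpgrade.lean`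
(extra import `Literature.Probability.RandomPlanarGeometry.SLEUniquenessInLaw`).
-/

open Filter Topology MeasureTheory
open scoped NNReal BoundedContinuousFunction

namespace Summit.CriticalPhenomena.CardyFormulaZ2.Cruxes.SubseqUpgrade.ScalarSubseqSleUniqueness

open Literature.Probability.RandomPlanarGeometry Literature.Probability.LatticeModels
  Literature.Probability.Percolation

/-- **Stub 1 — scalar subsequence principle on `𝓝[>] 0` (everywhere-positive sequences suffice).**
If every everywhere-positive null sequence `δs` has a sub-selection `φ : ℕ → ℕ` (no monotonicity
required — the strongest form, as in Mathlib) along which `u (δs (φ n)) → a`, then `u → a` along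
`𝓝[>] 0`. Mathlib `Filter.tendsto_of_subseq_tendsto` (the filter `𝓝[>] (0:ℝ)` is countably
generated) + `tendsto_nhdsWithin_iff` / `Filter.eventually_atTop` (a sequence tending to `0` within
`(0,∞)` is positive from some index `N` on; shift by `N`, `Filter.tendsto_add_atTop_nat`).
Billingsley (1999), Thm. 2.6, scalar form. Size S. [folklore] -/
theorem stub_scalarSubseq {u : ℝ → ℝ} {a : ℝ}
    (h : ∀ δs : ℕ → ℝ, (∀ n, 0 < δs n) → Tendsto δs atTop (𝓝 0) →
      ∃ φ : ℕ → ℕ, Tendsto (fun n ↦ u (δs (φ n))) atTop (𝓝 a)) :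
    Tendsto u (𝓝[>] (0 : ℝ)) (𝓝 a) := by
  sorry
  /- PROOF (kernel-checked in the closed variant, 2026-08-16):
  refine tendsto_of_subseq_tendsto fun s hs ↦ ?_
  rw [tendsto_nhdsWithin_iff] at hs
  obtain ⟨hs0, hpos⟩ := hs
  obtain ⟨N, hN⟩ := eventually_atTop.1 hpos
  obtain ⟨φ, hlim⟩ := h (fun n ↦ s (n + N)) (fun n ↦ hN _ (N.le_add_left n))
    (hs0.comp (tendsto_add_atTop_nat N))
  exact ⟨fun n ↦ φ n + N, hlim⟩
  -/

/-- **Stub 2 — uniqueness pin for subsequential SLE_κ limits (model-free, κ-general).**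
Random curves `Y δ : Ωδ δ → CurveClass ℂ` under laws `P δ`; if every everywhere-positive null
sequence of meshes has a subsequence along which the laws of `Y` converge, bounded-continuous-test-
function-wise, to SOME chordal SLE_κ law of `(D; a, b)`, then there is a chordal SLE_κ random curve
`Γ` in `D` such that every such sequence has a subsequence along which they converge to THE law of
`Γ` (`∫ f ∘ Γ d(preWiener)`); sub-selections `φ : ℕ → ℕ` carry no monotonicity condition on either
side (strongest usable form, cf. stub 1). The witness `Γ` is unpacked from the hypothesis along `1/(n+1)`
(`IsSLELaw κ D μ := ∃ Γ, IsSLECurve κ D Γ ∧ μ = preWienerMeasure.map Γ`); every other subsequential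
limit `μ` equals `preWienerMeasure.map Γ` by uniqueness of the chordal SLE_κ law
(`IsSLELaw.eq_map_of_isSLECurve`, PROVED in SLEUniquenessInLaw.lean from `IsSLECurve.map_eq_holds`),
and `∫ f dμ` is rewritten by `MeasureTheory.integral_map` (`IsSLECurve.aemeasurable`,
`f.continuous.aestronglyMeasurable`). This is the load-bearing step singled out by
`Disproof.not_subseqPrinciple_pair`. Lawler (2005), §6.1, §6.3; Billingsley (1999), Thm. 2.6.
Size S. [folklore] -/
theorem stub_slePin {κ : ℝ≥0} {D : DobrushinDomain}
    {Ωδ : ℝ → Type*} [∀ δ, MeasurableSpace (Ωδ δ)]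
    {Y : ∀ δ, Ωδ δ → CurveClass ℂ} {P : ∀ δ, Measure (Ωδ δ)}
    (hsub : ∀ s : ℕ → ℝ, (∀ n, 0 < s n) → Tendsto s atTop (𝓝 0) →
      ∃ φ : ℕ → ℕ, ∃ μ : Measure (CurveClass ℂ), IsSLELaw κ D μ ∧
        ∀ f : CurveClass ℂ →ᵇ ℝ,
          Tendsto (fun n ↦ ∫ ω, f (Y (s (φ n)) ω) ∂P (s (φ n))) atTop (𝓝 (∫ γ, f γ ∂μ))) :
    ∃ Γ : (ℝ≥0 → ℝ) → CurveClass ℂ, IsSLECurve κ D Γ ∧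
      ∀ s : ℕ → ℝ, (∀ n, 0 < s n) → Tendsto s atTop (𝓝 0) →
        ∃ φ : ℕ → ℕ, ∀ f : CurveClass ℂ →ᵇ ℝ,
          Tendsto (fun n ↦ ∫ ω, f (Y (s (φ n)) ω) ∂P (s (φ n))) atTop
            (𝓝 (∫ x, f (Γ x) ∂Literature.Probability.Process.preWienerMeasure)) := by
  sorry
  /- PROOF (kernel-checked in the closed variant, 2026-08-16):
  obtain ⟨-, μ₀, hμ₀, -⟩ := hsub (fun n ↦ 1 / ((n : ℝ) + 1))
    (fun n ↦ Nat.one_div_pos_of_nat) tendsto_one_div_add_atTop_nhds_zero_nat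
  obtain ⟨Γ, hΓ, -⟩ := hμ₀
  refine ⟨Γ, hΓ, fun s hs hs0 ↦ ?_⟩
  obtain ⟨φ, μ, hμ, hlim⟩ := hsub s hs hs0
  refine ⟨φ, fun f ↦ ?_⟩
  have h := hlim f
  rw [hμ.eq_map_of_isSLECurve hΓ,
    integral_map hΓ.aemeasurable f.continuous.aestronglyMeasurable] at h
  exact h
  -/

/-- **Composition — the crux from the two stubs (no `sorry` here).** Specialise the hypothesis of
`SubseqUpgrade` to the given `(D, E)`, pin all its subsequential limits to the law of one chordal
SLE₆ curve `Γ` (`stub_slePin` at `κ = 6`, `Ωδ _ = BondConfig (Site 2)`,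
`Y δ = bondInterfaceIn D (E δ)`, `P δ = bondPercolation (zdGraph 2) half`), copy the eventual
a.e.-measurability clause, and run the scalar subsequence principle `stub_scalarSubseq` once per
bounded continuous test function. -/
theorem SubseqUpgrade_of :
    Summit.CriticalPhenomena.CardyFormulaZ2.Theses.CardySelfRefinement.SubseqUpgrade := by
  rintro ⟨hmeas, hsub⟩ D E hE
  -- stub 2 (uniqueness pin): all subsequential limits of THIS `(D, E)` are the law of ONE SLE₆ curve
  obtain ⟨Γ, hΓ, hpin⟩ := stub_slePin (κ := 6) (D := D) (Ωδ := fun _ ↦ BondConfig (Site 2))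
    (Y := fun δ ↦ bondInterfaceIn D (E δ)) (P := fun _ ↦ bondPercolation (zdGraph 2) half)
    (fun s hs hs0 ↦ by
      obtain ⟨φ, -, P, hP, hlim⟩ := hsub s hs hs0
      exact ⟨φ, P D, hP D, hlim D E hE⟩)
  -- stub 1 (scalar subsequence principle), once per bounded continuous test function
  refine ⟨Γ, hΓ, hmeas D E hE, fun f ↦ stub_scalarSubseq fun s hs hs0 ↦ ?_⟩
  obtain ⟨φ, hlim⟩ := hpin s hs hs0
  exact ⟨φ, hlim f⟩

end Summit.CriticalPhenomena.CardyFormulaZ2.Cruxes.SubseqUpgrade.ScalarSubseqSleUniqueness
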